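import Mathlib
import Summits.Ventures.PercRepro2.M9LatticeHarrisGen

/-!
# Harris on a self-dual sublattice — monotonicity on the sublattice only (blind cell
PercRepro2, p3 g20, 2026-08-27)

`sum_sub_dual_mul_nonpos_of_sublattice` of `M9LatticeHarrisGen` asks for `G` monotone and `H`
antitone on the whole lattice; the functions of the single-`d` fibres are only controlled on
the legal vectors.  `sum_sub_dual_mul_nonpos_of_sublattice'` weakens the hypotheses to the
sublattice `L`: a function monotone on a finite sublattice extends monotonically to the whole
lattice through `x ↦ ⨆ {y ∈ L | y ≤ x}` (`projL`, the largest element of `L` below `x`, or the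
least element of `L` when there is none).  Own work, one seat.
-/

namespace Summit.Ventures.PercRepro2

namespace M9Reduce

open Finset Classical

variable {α : Type*} [Fintype α] [DecidableEq α] [DistribLattice α]

/-- The elements of `L` below `x`. -/
noncomputable def belowL (L : Finset α) (x : α) : Finset α := L.filter (fun y => y ≤ x)

/-- The projection to the sublattice: the largest element of `L` below `x`, or the least element
of `L` when no element of `L` lies below `x`. -/
noncomputable def projL (L : Finset α) (hL : L.Nonempty) (x : α) : α :=
  if h : (belowL L x).Nonempty then (belowL L x).sup' h id else L.inf' hL id

omit [Fintype α] [DecidableEq α] in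
/-- A finite sup of elements of `L` lies in `L` when `L` is closed under `⊔`. -/
lemma sup'_mem_of_supClosed {L : Finset α} (hsup : ∀ ⦃S T⦄, S ∈ L → T ∈ L → S ⊔ T ∈ L)
    {t : Finset α} (ht : t.Nonempty) (hts : t ⊆ L) : t.sup' ht id ∈ L :=
  Finset.sup'_mem (↑L : Set α) (fun _ hx _ hy => hsup hx hy) t ht id (fun _ hi => hts hi)

omit [Fintype α] [DecidableEq α] in
/-- A finite inf of elements of `L` lies in `L` when `L` is closed under `⊓`. -/
lemma inf'_mem_of_infClosed {L : Finset α} (hinf : ∀ ⦃S T⦄, S ∈ L → T ∈ L → S ⊓ T ∈ L)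
    {t : Finset α} (ht : t.Nonempty) (hts : t ⊆ L) : t.inf' ht id ∈ L :=
  Finset.inf'_mem (↑L : Set α) (fun _ hx _ hy => hinf hx hy) t ht id (fun _ hi => hts hi)

omit [Fintype α] [DecidableEq α] in
/-- The projection lies in `L`. -/
lemma projL_mem {L : Finset α} (hsup : ∀ ⦃S T⦄, S ∈ L → T ∈ L → S ⊔ T ∈ L)
    (hinf : ∀ ⦃S T⦄, S ∈ L → T ∈ L → S ⊓ T ∈ L) (hL : L.Nonempty) (x : α) :
    projL L hL x ∈ L := by
  unfold projL
  split_ifs with h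
  · exact sup'_mem_of_supClosed hsup h (Finset.filter_subset _ _)
  · exact inf'_mem_of_infClosed hinf hL (Finset.Subset.refl _)

omit [Fintype α] [DecidableEq α] in
/-- The projection of an element of `L` is itself. -/
lemma projL_of_mem {L : Finset α} (hL : L.Nonempty) {x : α} (hx : x ∈ L) :
    projL L hL x = x := by
  have hne : (belowL L x).Nonempty := ⟨x, Finset.mem_filter.2 ⟨hx, le_rfl⟩⟩
  unfold projL
  rw [dif_pos hne]
  apply le_antisymm
  · exact Finset.sup'_le hne id (fun y hy => (Finset.mem_filter.1 hy).2)
  · exact Finset.le_sup' (f := id) (s := belowL L x) (Finset.mem_filter.2 ⟨hx, le_rfl⟩)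

omit [Fintype α] [DecidableEq α] in
/-- The projection is monotone. -/
lemma projL_mono {L : Finset α} (hsup : ∀ ⦃S T⦄, S ∈ L → T ∈ L → S ⊔ T ∈ L)
    (hL : L.Nonempty) :
    Monotone (projL L hL) := by
  intro x x' hxx'
  have hsub : belowL L x ⊆ belowL L x' := fun y hy => by
    obtain ⟨hyL, hyx⟩ := Finset.mem_filter.1 hy
    exact Finset.mem_filter.2 ⟨hyL, hyx.trans hxx'⟩
  unfold projL
  split_ifs with h1 h2 h2
  · exact Finset.sup'_mono id hsub h1
  · exact (h2 (h1.mono hsub)).elim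
  · -- nothing below `x`: the least element of `L` is below everything of `L`
    have hmem := sup'_mem_of_supClosed hsup h2 (Finset.filter_subset _ _)
    exact Finset.inf'_le id hmem
  · exact le_rfl

/-- **Harris on a self-dual sublattice, monotonicity on the sublattice only.** -/
theorem sum_sub_dual_mul_nonpos_of_sublattice' {L : Finset α} {c : α → α}
    (hc : ∀ S, c (c S) = S) (hcanti : Antitone c)
    (hsup : ∀ ⦃S T⦄, S ∈ L → T ∈ L → S ⊔ T ∈ L) (hinf : ∀ ⦃S T⦄, S ∈ L → T ∈ L → S ⊓ T ∈ L)
    (hL : ∀ ⦃S⦄, S ∈ L → c S ∈ L) {G H : α → ℤ}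
    (hG : ∀ S ∈ L, ∀ T ∈ L, S ≤ T → G S ≤ G T) (hH : ∀ S ∈ L, ∀ T ∈ L, S ≤ T → H T ≤ H S) :
    ∑ S ∈ L, (G S - G (c S)) * H S ≤ 0 := by
  rcases L.eq_empty_or_nonempty with rfl | hne
  · simp
  -- the monotone / antitone extensions through the projection
  let G' : α → ℤ := fun x => G (projL L hne x)
  let H' : α → ℤ := fun x => H (projL L hne x)
  have hG' : Monotone G' := fun x x' hxx' =>
    hG _ (projL_mem hsup hinf hne x) _ (projL_mem hsup hinf hne x') (projL_mono hsup hne hxx')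
  have hH' : Antitone H' := fun x x' hxx' =>
    hH _ (projL_mem hsup hinf hne x) _ (projL_mem hsup hinf hne x') (projL_mono hsup hne hxx')
  have key := sum_sub_dual_mul_nonpos_of_sublattice hc hcanti hsup hinf hL hG' hH'
  refine le_trans (le_of_eq ?_) key
  refine Finset.sum_congr rfl (fun S hS => ?_)
  simp only [G', H']
  rw [projL_of_mem hne hS, projL_of_mem hne (hL hS)]

end M9Reduce

end Summit.Ventures.PercRepro2
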